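import Literature.AlgebraicGeometry.HodgeTheory.AlgebraicClassesPullbackHolds
import Literature.AlgebraicGeometry.HodgeTheory.HodgeClassesBlowupBirationalInvariance
import Literature.AlgebraicGeometry.HodgeTheory.HodgeClassesBlowupBirationalInvarianceProofs
import HarnessLib

/-!
# Hypothesis-free forms of the birational-invariance consequences of Murre–Arapura's blow-up lemma

Topic `Literature/AlgebraicGeometry/HodgeTheory`. THEOREMS ONLY (no definition, no named fact). Fourth
file of the series `AlgebraicClassesPullbackConsequences*`: the theorems of
`HodgeClassesBlowupBirationalInvariance` and `HodgeClassesBlowupBirationalInvarianceProofs` (Arapura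
2001, Lemma 16 / Cor. 17: the Hodge conjecture is stable under smooth blow-ups, hence a birational
invariant in dimension `≤ 5` by weak factorisation / Hironaka; Murre 1977 for unirational fourfolds)
that carry the blow-up fact `Arapura2001_hodgeClasses_algebraic_smoothBlowup` as an explicit hypothesis
`h`, restated WITHOUT it — primed names, statements otherwise verbatim, proofs by the discharge
`Arapura2001_hodgeClasses_algebraic_smoothBlowup_holds` (`AlgebraicClassesPullbackHolds`: Fulton's
pull-back of algebraic classes by deformation to the normal cone, then `SmoothBlowupHodgeConjecture`).
Statements already made unconditional in `AlgebraicClassesPullbackHolds` are not repeated.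

## References

* [Arapura2001HodgeCyclesModuli] D. Arapura, Motivation for Hodge cycles, Lemma 13, 16, 18, Cor. 17.
* [Murre1977] J. P. Murre, On the Hodge conjecture for unirational fourfolds, Indag. Math. 39 (1977).
* [Fulton1998] W. Fulton, Intersection Theory, 2nd ed. (1998), §19.2 Cor. 19.2 (b).
-/

noncomputable section

open CategoryTheory AlgebraicGeometry
open Literature.AlgebraicGeometry.Motives Literature.AlgebraicGeometry.Resolution
open CategoryTheory CategoryTheory.Limits AlgebraicGeometry TopologicalSpace

namespace Literature.AlgebraicGeometry.HodgeTheory.Arapura2001_hodgeClasses_algebraic_smoothBlowup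

/-! ### From `HodgeClassesBlowupBirationalInvariance` -/

/-- (Hypothesis-free form of `of_centre_dim_le_three`: `Arapura2001_hodgeClasses_algebraic_smoothBlowup` is now the
Literature theorem `Arapura2001_hodgeClasses_algebraic_smoothBlowup_holds`.) **Centres of dimension `≤ 3` cost nothing**: the statement for `X` alone passes to the blow-up
`X'` when `dim Z ≤ 3`, the centre being covered by the tree's THEOREM
`hodgeConjectureFor_of_dim_le_three_holds` (Lefschetz `(1,1)` + hard Lefschetz; "it is well known
that the Hodge [statement] holds in dimensions up to `3`", Arapura, proof of Cor. 17; da Silva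
Lemma 2.16). [cite: Arapura2001HodgeCyclesModuli, proof of Cor. 17] [cite: DaSilva2021KnownCasesHC, Lemma 2.16] -/
theorem of_centre_dim_le_three'
    {n k : ℕ} {X Z X' : SchemeOver ℂ} (i : Z ⟶ X) (b : X' ⟶ X)
    (hb : IsSmoothBlowupAlong n k X Z X' i b) (hk : k ≤ 3) (hX : HodgeConjectureFor n X) :
    HodgeConjectureFor n X' :=
  of_centre_dim_le_three Arapura2001_hodgeClasses_algebraic_smoothBlowup_holds i b hb hk hX

/-- (Hypothesis-free form of `of_reflTransGen_smoothBlowupStep_of_centres`: `Arapura2001_hodgeClasses_algebraic_smoothBlowup` is now the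
Literature theorem `Arapura2001_hodgeClasses_algebraic_smoothBlowup_holds`.) **Up a tower in any dimension, modulo the statement for the centres** (all smooth projective
varieties of dimension `≤ n - 2`). [cite: Arapura2001HodgeCyclesModuli, Lemma 16 and proof of Cor. 17] -/
theorem of_reflTransGen_smoothBlowupStep_of_centres'
 {n : ℕ}
    (hlow : ∀ ⦃k : ℕ⦄ ⦃Z : SchemeOver ℂ⦄, k + 2 ≤ n → IsSmoothProjective k Z → HodgeConjectureFor k Z)
    {X X'' : SchemeOver ℂ} (ht : Relation.ReflTransGen (SmoothBlowupStep n) X X'')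
    (hX : HodgeConjectureFor n X) :
    HodgeConjectureFor n X'' :=
  of_reflTransGen_smoothBlowupStep_of_centres Arapura2001_hodgeClasses_algebraic_smoothBlowup_holds hlow ht hX

end Literature.AlgebraicGeometry.HodgeTheory.Arapura2001_hodgeClasses_algebraic_smoothBlowup

namespace Literature.AlgebraicGeometry.HodgeTheory

/-! ### From `HodgeClassesBlowupBirationalInvarianceProofs` -/

/-- (Hypothesis-free form of `HaveCommonSmoothModel.hodgeConjectureFor_of_le_five'`: `Arapura2001_hodgeClasses_algebraic_smoothBlowup` is now the
Literature theorem `Arapura2001_hodgeClasses_algebraic_smoothBlowup_holds`.) **Transfer along a common smooth model, `n ≤ 5`, modulo the blow-up closure alone.**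
[cite: Arapura2001HodgeCyclesModuli, Cor. 17 (proof)] -/
theorem HaveCommonSmoothModel.hodgeConjectureFor_of_le_five''
    {n : ℕ} (hn : n ≤ 5) {X X' : SchemeOver ℂ} (hX : IsSmoothProjective n X)
    (hX' : IsSmoothProjective n X') (hc : HaveCommonSmoothModel n X X') (h : HodgeConjectureFor n X) :
    HodgeConjectureFor n X' :=
  HaveCommonSmoothModel.hodgeConjectureFor_of_le_five' Arapura2001_hodgeClasses_algebraic_smoothBlowup_holds hn hX hX' hc h

/-- (Hypothesis-free form of `hodgeConjectureFor_of_isBirational_of_centres`: `Arapura2001_hodgeClasses_algebraic_smoothBlowup` is now the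
Literature theorem `Arapura2001_hodgeClasses_algebraic_smoothBlowup_holds`.) **Climbing a birational morphism, modulo the blow-up closure and the statement for the centres**:
if rational `(p,p)`-classes are algebraic on the smooth projective `n`-fold `X` and on every smooth
projective variety of dimension `≤ n - 2`, then they are algebraic on every smooth projective `X''`
mapping birationally onto `X` (climb the tower by Lemma 16, descend `X₃ → X''` by the tree's
`HodgeConjectureFor.of_surjective`). [cite: Arapura2001HodgeCyclesModuli, Lemma 16 and proof of Cor. 17] -/
theorem hodgeConjectureFor_of_isBirational_of_centres'
    {n : ℕ}
    (hlow : ∀ ⦃k : ℕ⦄ ⦃Z : SchemeOver ℂ⦄, k + 2 ≤ n → IsSmoothProjective k Z → HodgeConjectureFor k Z)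
    {X X'' : SchemeOver ℂ} (hX : IsSmoothProjective n X) (hX'' : IsSmoothProjective n X'')
    (p : X'' ⟶ X) (hp : IsBirational p.left) (h : HodgeConjectureFor n X) :
    HodgeConjectureFor n X'' :=
  hodgeConjectureFor_of_isBirational_of_centres Arapura2001_hodgeClasses_algebraic_smoothBlowup_holds hlow hX hX'' p hp h

/-- (Hypothesis-free form of `exists_tower_top_hodgeConjectureFor_of_roof_projectiveSpace_le_five`: `Arapura2001_hodgeClasses_algebraic_smoothBlowup` is now the
Literature theorem `Arapura2001_hodgeClasses_algebraic_smoothBlowup_holds`.) **The same with a target of any dimension, as a domination statement**: a roof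
`ℙⁿ ← W → Y` as above exhibits `Y` as the surjective image of the top of a smooth blow-up tower over
`ℙⁿ_ℂ` whose top satisfies the Hodge `(p,p)` statement (modulo the blow-up closure, `n ≤ 5`); the
descent to `Y` along a surjection of arbitrary relative dimension is Arapura 2001 Lemma 13 / Cor. 15
(the Summits-layer theorem `Ring2.Hypotheses.hodgeConjectureFor_of_surjective`, not importable here).
[cite: Arapura2001HodgeCyclesModuli, Lemma 13, Cor. 15 and Lemma 18] -/
theorem exists_tower_top_hodgeConjectureFor_of_roof_projectiveSpace_le_five'
    {n : ℕ} (hn : n ≤ 5) {W Y : SchemeOver ℂ} (hW : IsSmoothProjective n W)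
    (p : W ⟶ projectiveSpace n ℂ) (hp : IsBirational p.left) (q : W ⟶ Y) [Surjective q.left] :
    ∃ (X₃ : SchemeOver ℂ) (r : X₃ ⟶ Y), IsSmoothProjective n X₃ ∧ Surjective r.left ∧ HodgeConjectureFor n X₃ :=
  exists_tower_top_hodgeConjectureFor_of_roof_projectiveSpace_le_five Arapura2001_hodgeClasses_algebraic_smoothBlowup_holds hn hW p hp q

end Literature.AlgebraicGeometry.HodgeTheory

end
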